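import Mathlib
import HarnessLib
import Summits.QuantumFields.YangMills.Theses.PencilRigidity
import Literature.MathematicalPhysics.QuantumLattice.WilsonLoops

/-!
# Crux ideation sketches for `HypercubicLimit` (stmt-QuantumFields-8646), ideator 2, round 1

First lemmas of the three crux idea cards (`Ideas/*.md` in this folder). Statements only
(`def … : Prop`), typed over existing declarations; nothing here is asserted.
-/

namespace Summit.QuantumFields.YangMills.Cruxes.HypercubicLimit.Sketch

open MeasureTheory Filter Topology
open Literature.MathematicalPhysics.QuantumLattice Literature.MathematicalPhysics.QuantumFieldTheory

/-! ## Card `scale-locked-assembly` — first lemma: the anti-hierarchy (scale-locking) inequality.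

A completely monotone lattice two-point function `G(n) = ∫ λⁿ dν(λ)` (reflection positivity,
`ν` = spectral measure of the plaquette vector, `supp ν ⊂ [0, e^{-m}]`, `m` = its exponential rate)
that obeys a power-law LOWER bound `A N^{-p} ≤ G(N)` at the far end `N` of the ultraviolet window
and an UPPER bound `G(n₀) ≤ B n₀^{-p}` at its near end cannot decay faster than
`m ≤ (p log(N/n₀) + log(B/A)) / (N - n₀)`: the curvature species' own mass is locked below
`C/N`, i.e. to the scale the window reaches. Elementary (`G(N) ≤ e^{-m(N-n₀)} G(n₀)`). -/
def ScaleLock : Prop :=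
  ∀ (ν : Measure ℝ) [IsFiniteMeasure ν] (m A B p : ℝ) (n₀ N : ℕ),
    0 ≤ m → 0 < A → 0 < n₀ → n₀ < N →
    ν (Set.Icc (0 : ℝ) (Real.exp (-m)))ᶜ = 0 →
    A * (N : ℝ) ^ (-p) ≤ ∫ t, t ^ N ∂ν →
    ∫ t, t ^ n₀ ∂ν ≤ B * (n₀ : ℝ) ^ (-p) →
      m ≤ (p * Real.log ((N : ℝ) / n₀) + Real.log (B / A)) / ((N : ℝ) - n₀)

/-! ## Card `ungauged-transfer-gap` — first lemma: quantitative Simon–Yaffe.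

Small-rotation averaging in the Simon–Yaffe lemma (Phys. Lett. 115B (1982) 145, eqs. (4), (12))
replaces their `c = exp(-4(d-1)β dim)` by an optimised `κ ε² e^{-6βε dim}`, `ε ~ 1/β`: every
non-gauge-invariant eigenvalue of Wilson's transfer matrix is at least `C_G/β²` (relatively) below
the top one, uniformly in the volume. Typed through its perimeter-law corollary on the symmetric
tori of the Statement (time-like `l × t` loops in the `(0,1)` plane, Wilson's action in the
faithful representation `r`, tree normalisation of `wilsonMeasure`). -/
def ChargedSectorsAreHeavy : Prop :=
  ∀ (G : Type) [Group G] [TopologicalSpace G] [IsTopologicalGroup G] [CompactSpace G]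
    [MeasurableSpace G] [BorelSpace G] (r : LatticeRep G),
    ∃ C : ℝ, 0 < C ∧ ∀ β : ℝ, 1 ≤ β → ∀ (S l t : ℕ), 1 ≤ l → 1 ≤ t →
      |∫ U, wilsonLoopObs (fun g => (r.ρ g).trace.re)
            (rectWalk (0 : Literature.Probability.LatticeModels.Site 4) 0 1 l t)
            (torusLift (2 * S + 1) U)
          ∂(wilsonMeasure (d := 4) (L := 2 * S + 1) r.ρ β)|
        ≤ (r.N : ℝ) * (1 - C / β ^ 2) ^ (t - 1)

/-! ## Card `running-pole-skewness` — first lemma: Feynman–Hellmann for the torus Wilson state.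

`d/dβ ⟨F⟩_{Λ,β} = -Cov_{Λ,β}(F, S_W)` for the tree's `wilsonMeasure` (`Z⁻¹ e^{-β S_W} ∏ dU_e`,
`S_W = ∑ₚ (N - Re tr ρ(U_p))`) and every bounded continuous observable `F` on the finite torus:
the plaquette field is the observable conjugate to the coupling. Differentiation under the
integral sign on the compact configuration space `G^{E(Λ)}`. -/
def FeynmanHellmann : Prop :=
  ∀ (G : Type) [Group G] [TopologicalSpace G] [IsTopologicalGroup G] [CompactSpace G]
    [MeasurableSpace G] [BorelSpace G] {N : ℕ} (ρ : G →* Matrix (Fin N) (Fin N) ℂ),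
    Continuous ρ → ∀ (L : ℕ) [NeZero L] (F : GaugeConfig 4 L G → ℝ), Continuous F → ∀ β : ℝ,
      HasDerivAt (fun b : ℝ => ∫ U, F U ∂(wilsonMeasure (d := 4) (L := L) ρ b))
        (-((∫ U, F U * wilsonAction ρ U ∂(wilsonMeasure (d := 4) (L := L) ρ β)) -
            (∫ U, F U ∂(wilsonMeasure (d := 4) (L := L) ρ β)) *
              ∫ U, wilsonAction ρ U ∂(wilsonMeasure (d := 4) (L := L) ρ β)))
        β

/-! ### The crux, by name (what every line must conclude). -/
example : Prop := Summit.QuantumFields.YangMills.Theses.PencilRigidity.HypercubicLimit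

end Summit.QuantumFields.YangMills.Cruxes.HypercubicLimit.Sketch
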